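import Summits.BirchSwinnertonDyer.BirchSwinnertonDyer.Theorems.SignedBaseChangeAnticyclotomicEisensteinDivisibilityAdmdefUnitLambdaOfLoc
import Summits.BirchSwinnertonDyer.BirchSwinnertonDyer.Theorems.SignedBaseChangeAnticyclotomicEisensteinDivisibilityAdmdefSelmerWalk
import Summits.BirchSwinnertonDyer.BirchSwinnertonDyer.Theorems.AdditiveKolyvaginRoadEigen
import Literature.NumberTheory.EllipticCurves.HeegnerPointsKolyvaginSelmerProofs
import HarnessLib

/-!
# Line `admdef` on the crux `AnticyclotomicEisensteinDivisibility` (stmt-BirchSwinnertonDyer-20727), LEAD gen 25: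
# THE WALK OF LENGTH ONE — in Selmer corank one a SINGLE Bertolini–Darmon admissible prime is a Selmer-zero vertex, so the v23 anchor
# (rank-0 converse at odd Selmer-zero vertices, `Lines/admdef.lean` v23 `stub_definiteAnchorFW/NFW`) is needed at ONE prime to give [NV] at `d = 1`

Lead seat bsd-line-sbc-p1 (gen 25), `--supports stmt-BirchSwinnertonDyer-20727`.  Skeleton v23 replaced the core-root research text (RV₁)H (Kolyvagin's
conjecture mod `p` in corank one) by v7's print-natural anchor «at EVERY odd Selmer-zero vertex of the level-raised walk, Brandt data with non-zero weighted
toric period», on the grounds that W. Zhang's walk reaches a zero vertex from every odd Selmer rank — of length ONE at `d = 1`.  This file makes that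
claim a standalone kernel statement in the AKR currency `SelQP`:

* §1 `exists_admQ_zeroVertex_of_finrank_eq_one` — frame of cell β (`p ≥ 5`, `ρ̄_{E,p}` onto, `K` imaginary quadratic, every `ℓ ∣ N_E` split, `p` split,
  `c` the complex conjugation): if `dim_𝔽p Sel_p(E/K)[p] = 1` then there is ONE admissible prime `q` with `Sel_{q}^+ = Sel_{q}^- = 0` (the zero vertex `{q}`,
  of odd cardinality `1`) — `…AdmdefSelmerWalk.exists_zero_vertex_above_of_split` at level `∅` (its level has cardinality `dim Sel⁺_∅ + dim Sel⁻_∅`) and the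
  eigen-decomposition `AdditiveKoly.finrank_selmer_eq_finrank_selQP_add`.  [Zha14 Prop. 5.4 / Lemma 7.3: a Čebotarev prime at which the generator localises
  non-trivially kills the line.]
* §2 `hasUnitLambda_of_anchorOne_of_finrank_eq_one` — for a signed bipartite system `B` at level `N = N_E` whose elements `λ_1(q)` satisfy the BRIDGE clause (b)
  at single primes («Brandt data with non-zero weighted toric period at level `N·q` ⟹ `λ_1(q)(0) ∈ ℤ_pˣ`, cites (15)–(16) in the line), and the ANCHOR asked
  only at cardinality-ONE zero vertices: `dim Sel_p(E/K)[p] = 1 ⟹ B.HasUnitLambda N` ([NV], Howard's criterion).  So at `d = 1` the composition needs the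
  rank-0 converse for ONE level-raised form `g_q` (and its `χ_K`-twist) — CHKLL25 Thm. 7.6's shape at the level `N·q`.

Theorems only (0 definitions, 0 named facts, 0 `sorry`, standard axioms); nothing is closed.  BSD / the crux / the anchors are NOT proved by this file.

## References
* [WZhang2014] W. Zhang, Camb. J. Math. 2 (2014): Prop. 5.4, Lemma 7.3, proof of Thm. 9.1.
* [CastellaEtAl2025] arXiv:2308.10474v2: Thm. 7.5 (Howard's criterion), Thm. 7.6, §7.4.
* [Howard2006] Thm. 3.2.3 (c).
-/

-- D-0017: single-problem summit, the namespace repeats the problem name by design.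
set_option linter.dupNamespace false
set_option autoImplicit false

noncomputable section

open scoped Classical NumberField

open NumberField IsDedekindDomain Field Module
open Literature.NumberTheory.EllipticCurves Literature.NumberTheory.GaloisRepresentations
open Literature.NumberTheory.EllipticCurves.BertoliniDarmon2005
open Literature.NumberTheory.EllipticCurves.CastellaHsuKunduLeeLiu2025
open Literature.NumberTheory.Automorphic
open Summit.BirchSwinnertonDyer.BirchSwinnertonDyer.Theorems
open Summit.BirchSwinnertonDyer.BirchSwinnertonDyer.Theorems.AdditiveKoly

namespace Summit.BirchSwinnertonDyer.BirchSwinnertonDyer.Theorems.SignedBaseChangeAcDivAdmdefWalkLengthOne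

variable {K : Type} [Field K] [NumberField K] {W : WeierstrassCurve ℚ} [W.IsElliptic] [W.IsGloballyMinimal] {p : ℕ} [Fact p.Prime]

/-! ## §1 In corank one a single admissible prime is a Selmer-zero vertex -/

/-- **THE WALK OF LENGTH ONE.**  On the frame of cell β (`p ≥ 5`, `ρ̄_{E,p}` onto, `K` imaginary quadratic, `N_E` Heegner in `K`, `p` split, `c ≠ 1` with
`c² = 1`): if `dim_𝔽p Sel_p(E/K)[p] = 1` then some Bertolini–Darmon admissible prime `q` alone is a ZERO VERTEX of the level-raised Selmer walk,
`Sel_{q}^+ = Sel_{q}^- = 0` (`SelQP … {q} μ = ⊥` for both signs).  W. Zhang's rank lowering (Prop. 5.4 with the Čebotarev prime of Lemma 7.3), read off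
`…AdmdefSelmerWalk.exists_zero_vertex_above_of_split` at level `∅` and the eigen-decomposition `dim Sel = dim Sel⁺_∅ + dim Sel⁻_∅`.
[cite: WZhang2014, Prop. 5.4, Lemma 7.3, Thm. 9.1 (proof)] [cite: CastellaEtAl2025, §7.4] -/
theorem exists_admQ_zeroVertex_of_finrank_eq_one (h5 : 5 ≤ p) (hsurj : W.HasSurjectiveModNGaloisRep p) (hK : IsImaginaryQuadratic K)
    (hH : SatisfiesHeegnerHypothesis (W.conductorNorm ℤ) K) (hsp : ((Ideal.span {(p : ℤ)}).primesOver (𝓞 K)).ncard = 2)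
    {c : K ≃ₐ[ℚ] K} (hc1 : c ≠ 1) (hcc : c * c = 1) [Module (ZMod p) (Vp W K p)]
    (hd1 : finrank (ZMod p) (AddSubgroup.toZModSubmodule p (WeierstrassCurve.selmerGroup (W.baseChange K) ((p ^ 1 : ℕ) : ℤ))) = 1) :
    ∃ q : AdmQ W K p, ∀ μ : Bool, SelQP W K p c {q} μ = ⊥ := by
  have hp2 : p ≠ 2 := by omega
  obtain ⟨n, -, hzero, hcard⟩ := SignedBaseChangeAcDivAdmdefSelmerWalk.exists_zero_vertex_above_of_split W K p h5 hsurj hK hH hsp hc1 ∅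
  rw [Finset.card_empty, zero_add, ← finrank_selmer_eq_finrank_selQP_add W K p hp2 hK c hcc, hd1] at hcard
  obtain ⟨q, hq⟩ := Finset.card_eq_one.mp hcard
  exact ⟨q, fun μ ↦ by rw [← hq]; exact hzero μ⟩

/-! ## §2 [NV] at `d = 1` from the anchor at cardinality-one vertices and the bridge's clause (b) at single primes -/

/-- **[NV] in corank one from the anchor at ONE prime.**  Let `B` be a signed bipartite system at level `N = N_E` (only its elements `λ_1(q)` enter) with
the BRIDGE clause (b) at single admissible primes: Brandt data at level `N·q` (definite set-up `S` of type `(N, q)`, Gross point `(ψ, I)` of `K`, mod-`p`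
eigenvector `φ` for `a_•(E)` off the level) with non-zero WEIGHTED toric period ⟹ `λ_1(q)(0) ∈ ℤ_pˣ` (in the line: cite (16)'s dictionary + MULT1, cite
(15)).  Suppose the ANCHOR holds at every zero vertex `{q}` of cardinality one (the `n = {q}` instances of v23's registered texts
`AdmdefLine.DefiniteAnchorFWNS` ∕ `…NFWNS`).  If `dim_𝔽p Sel_p(E/K)[p] = 1` then `B.HasUnitLambda N` — Howard's non-vanishing criterion [NV], with
witness `j = 1` and the definite vertex `q ∈ 𝒩_1^def` supplied by §1.  No Kolyvagin-conjecture statement is used.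
[cite: WZhang2014, Prop. 5.4, Thm. 9.1 (proof)] [cite: CastellaEtAl2025, Thm. 7.5, Thm. 7.6, §7.4 (arXiv:2308.10474v2 pp. 31–33)] [cite: Howard2006, Thm. 3.2.3 (c)] -/
theorem hasUnitLambda_of_anchorOne_of_finrank_eq_one {κ : ZpExtension K p} (B : SignedBipartiteSystem W K p κ) {N : ℕ}
    (hN : (N : ℤ) = W.conductorNorm ℤ) (h5 : 5 ≤ p) (hsurj : W.HasSurjectiveModNGaloisRep p) (hK : IsImaginaryQuadratic K)
    (hHeeg : ∀ ℓ : ℕ, ℓ.Prime → ℓ ∣ N → ((Ideal.span {(ℓ : ℤ)}).primesOver (𝓞 K)).ncard = 2)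
    (hsp : ((Ideal.span {(p : ℤ)}).primesOver (𝓞 K)).ncard = 2) [Module (ZMod p) (Vp W K p)]
    (hbridge : ∀ q : ℕ, IsAdmissiblePrime N K (fun ℓ ↦ W.frobeniusTrace ℓ) p 1 q →
      (∃ (S : Brandt.XiSetup N q) (ψ : K →ₐ[ℚ] S.D) (I : Submodule ℤ S.D) (φ : Brandt.ClassSet S.O → ZMod p),
          Brandt.IsGrossPoint S.O ψ I ∧
          (letI : Fintype (Brandt.ClassSet S.O) := Fintype.ofFinite _
           φ ∈ Brandt.eigenSpace (ZMod p) (N * q) (Brandt.matrix S.O) (fun ℓ ↦ W.frobeniusTrace ℓ)) ∧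
          Brandt.toricPeriod S.O ψ I (fun i ↦ (Brandt.weight S.O i : ZMod p) * φ i) ≠ 0) →
      IsUnit (PowerSeries.constantCoeff (B.lam 1 q)))
    (hanch : ∀ (c : K ≃ₐ[ℚ] K), c ≠ 1 → ∀ q : AdmQ W K p, (∀ μ : Bool, SelQP W K p c {q} μ = ⊥) →
      ∃ (S : Brandt.XiSetup N (q : ℕ)) (ψ : K →ₐ[ℚ] S.D) (I : Submodule ℤ S.D) (φ : Brandt.ClassSet S.O → ZMod p),
          Brandt.IsGrossPoint S.O ψ I ∧
          (letI : Fintype (Brandt.ClassSet S.O) := Fintype.ofFinite _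
           φ ∈ Brandt.eigenSpace (ZMod p) (N * (q : ℕ)) (Brandt.matrix S.O) (fun ℓ ↦ W.frobeniusTrace ℓ)) ∧
          Brandt.toricPeriod S.O ψ I (fun i ↦ (Brandt.weight S.O i : ZMod p) * φ i) ≠ 0)
    (hd1 : finrank (ZMod p) (AddSubgroup.toZModSubmodule p (WeierstrassCurve.selmerGroup (W.baseChange K) ((p ^ 1 : ℕ) : ℤ))) = 1) :
    B.HasUnitLambda N := by
  have hN' : N = W.conductorNorm ℤ := by exact_mod_cast hN
  have hH : SatisfiesHeegnerHypothesis (W.conductorNorm ℤ) K := fun ℓ hℓ hℓN ↦ hHeeg ℓ hℓ (hN' ▸ hℓN)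
  obtain ⟨c, hc1, hcc⟩ := exists_conj_of_isImaginaryQuadratic (K := K) hK
  obtain ⟨q, hzero⟩ := exists_admQ_zeroVertex_of_finrank_eq_one h5 hsurj hK hH hsp hc1 hcc hd1
  have hadm : IsAdmissiblePrime N K (fun ℓ ↦ W.frobeniusTrace ℓ) p 1 (q : ℕ) := by rw [hN']; exact q.2
  refine ⟨1, one_pos, (q : ℕ), SignedBaseChangeAcDivAdmdefUnitLambdaOfLoc.mem_defProducts_of_isAdmissiblePrime hadm, ?_⟩
  exact hbridge (q : ℕ) hadm (hanch c hc1 q hzero)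

end Summit.BirchSwinnertonDyer.BirchSwinnertonDyer.Theorems.SignedBaseChangeAcDivAdmdefWalkLengthOne

end
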